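import Mathlib.MeasureTheory.Function.Jacobian
import Literature.MathematicalPhysics.QuantumFieldTheory.Balaban1983to89.B10Eq18SigmaSU2Haar

/-!
# BalabanUVNodes ∕ N08 — THE ENGINE FRAME FOR (H_K) ON `SU(2)`: A PUSH-FORWARD (CHANGE-OF-VARIABLES) INEQUALITY THROUGH PRINT'S
# EXPONENTIAL CHART, FROM INJECTIVITY WINDOWS AND A HAAR-JACOBIAN FLOOR — `Haar ∘ ψ⁻¹ ≤ (m⁻¹·#windows + 1) · Haar`

WIDTH SEAT `pub-ymgap-dag-n08-w3` g4, `W-SEAT-START-LIST.md` v10 §0 (iii); item-3 lineage part 21, 2026-08-28.  DAG node N08 = [Balaban1985UV3] Thm 1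
p. 257 (compact) + Thm 2 p. 272; key item K1⁷ `StabilityBAtRecordR13SepCoPH` (stmt-QuantumFields-20542), `--supports … --as helper`.  COUNT-NEUTRAL.

THE POINT.  Part 20 (`…GuardOneStepBound.smul_map_avgFun_le`) bounds the one-step transport of `dU` under the typed (0.4) averaging MODULO the
hypothesis (H_K) on the one-variable fibre maps `ψ_{U,c} : g ↦ Ū(c)(U[β(c) ↦ g])` of the guarded branch: `Haar ∘ ψ⁻¹ ≤ K · Haar`.  The missing
«quantitative local-diffeomorphism engine» that should produce `K` has a purely measure-theoretic half, typed here once and for all at `N = 2` on the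
chart the tree holds — print's `dU′ = σ_{SU(2)}(|A|) d³A` through `A ↦ exp(iΣA^aσ_a)` on the injectivity ball `{|A| < π}` ([Balaban1985UV3] p. 260;
`B10Eq18SigmaSU2Haar.map_expPauli_sigmaMeasure`, `σ = σ₀·det(d exp)` = [Helgason2000] Ch. I Thm 1.14):

 §1 [folklore] the WEIGHTED CHANGE-OF-VARIABLES INEQUALITY on a finite-dimensional real space (Mathlib's injective change of variables
    `lintegral_image_eq_lintegral_abs_det_fderiv_mul`): `f` injective and differentiable on a measurable `s` with the floor `m·w(x) ≤ |det f′(x)|·w(f x)`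
    ⟹ `m·∫_s w ≤ ∫_{f(s)} w`, hence `m·∫_{s ∩ f⁻¹B} w ≤ ∫_B w` (`mul_setLIntegral_inter_preimage_le`);
 §2 ONE CHART WINDOW (`mul_haar_window_inter_preimage_le`), for any two CHARTS `χ₀`, `χ₁` (continuous `ℝ³ → SU(2)`, injective on `{|A| < π}`, pushing
    `σ(A)dA` to Haar — print's `A ↦ exp iA` and all its left translates `A ↦ g·exp iA`, `chart_expPauli` ∕ `map_mul_expPauli_sigmaMeasure`, so windows may be
    centred ANYWHERE in source and target): if on a measurable window `W ⊆ {|A| < π}` the Borel map `ψ : SU(2) → SU(2)` is conjugate to `ψc : ℝ³ → ℝ³`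
    (`ψ(χ₀ A) = χ₁(ψc A)`, `ψc(W) ⊆ {|A| < π}`), injective and differentiable on `W`, with the HAAR-JACOBIAN FLOOR `m·σ(|A|) ≤ |det ψc′(A)|·σ(|ψc A|)` on `W`,
    then `m · Haar(χ₀(W) ∩ ψ⁻¹E) ≤ Haar(E)` for every Borel `E` — since `σ = σ₀·det(d exp)` the floor IS `m ≤ |det dψ|` in Haar-normalised trivialisations,
    the quantity n08-w6's determinant form of the sharp Jacobian bound (CLAIM-1 I.31429, over p612264) supplies for the printed exp-mean-log fibre map once
    its chain rule is typed;
 §3 [folklore] WINDOWS ADD UP (`mul_measure_inter_preimage_le_card_mul`, any measure space): a set `S` covered by finitely many pieces each obeying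
    `m·μ(V_k ∩ ψ⁻¹E) ≤ μ(E)` obeys `m·μ(S ∩ ψ⁻¹E) ≤ #pieces·μ(E)`, i.e. `m • (μ↾S)∘ψ⁻¹ ≤ #pieces • μ` (`smul_map_restrict_le`); and the (H_K) ASSEMBLY
    (`map_le_smul_of_restrict`): if off `S` the map `ψ` agrees with a `μ`-preserving `τ` then `μ∘ψ⁻¹ ≤ (m⁻¹·#pieces + 1) • μ`;
 §4 THE FRAME AT `SU(2)` (★ `haar_map_le_of_windows`): windows `g₀(k)·exp(iW_k)` as in §2 (target charts `g₁(k)·exp(i·)`) covering `S`, `ψ = τ` off `S`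
    with `Haar∘τ⁻¹ ≤ Haar` ⟹ `Haar ∘ ψ⁻¹ ≤ (m⁻¹·#windows + 1) • Haar` — LITERALLY the shape of (H_K) (`HaarData.haar = haarProbability SU(2)` is `rfl`, part 10
    `haarData_haar_eq`; off the guard the fibre map IS the Haar translation `g ↦ pre·g·post`, part 20 `map_fibre_eq_haar_of_not_exists`).

WHAT REMAINS FOR (H_K) AFTER THIS FILE (located, not typed): (E3) the chart conjugate of the guarded fibre map — differentiability of
`g ↦ Ū(c)(U[β(c) ↦ g])` with left-trivialised differential = pub-balaban's `emlD` (every loop of (0.4) at `c` carries `β(c)` exactly once), and the floor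
`m = ((1 − Σcᵢ)·sin ρ∕ρ)³` (part 14) resp. `(1 − Σcᵢ)³` (n08-w6, determinant form); (E4) injectivity windows covering the guard-admitting `g`-set and their
NUMBER — from chart-coercivity (needs a tangent UPPER bound) or from the conjectured global `(1−Σcᵢ)`-expansion (HOME note `N08-EML-JACOBIAN.md` §2; then ONE
window).  Nothing here asserts either.

HONEST FRAMING.  [folklore] measure theory on the landed chart; nothing of Bałaban's asserted; (H_K) NOT discharged; E6′ NOT decided; `hmass` NOT supplied;
count-neutral; N08 NOT discharged; counts unmoved (typed 28∕28 · discharged 5∕27); one finite 𝕋⁴ programme at fixed ε — R4 closes the CONDITIONAL rung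
`BalabanLadder.UV` only; the Yang–Mills mass gap (Clay) is NOT proved; nothing continuum ∕ OS.  0 `sorry`, 0 `def`, standard axioms.
-/

noncomputable section

open MeasureTheory Set Metric Function
open scoped ENNReal

namespace Summit.QuantumFields.YangMills.BalabanUVNodes.N08HaarCompatibilityGuardChartTransfer

/-! ## §1 [folklore] The weighted change-of-variables inequality -/

section General

/-- A continuous-on-`s` map pulls Borel sets back to Borel subsets of the measurable set `s` (plumbing: the restriction to the subtype is continuous,
and `s ∩ f⁻¹B` is the image of its preimage under the subtype embedding). [folklore] -/
theorem measurableSet_inter_preimage_of_continuousOn {α β : Type*} [TopologicalSpace α] [MeasurableSpace α] [BorelSpace α]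
    [TopologicalSpace β] [MeasurableSpace β] [BorelSpace β] {f : α → β} {s : Set α} {B : Set β}
    (hf : ContinuousOn f s) (hs : MeasurableSet s) (hB : MeasurableSet B) : MeasurableSet (s ∩ f ⁻¹' B) := by
  have hc : Continuous (s.restrict f) := continuousOn_iff_continuous_restrict.1 hf
  have h : s ∩ f ⁻¹' B = Subtype.val '' ((s.restrict f) ⁻¹' B) := by
    ext x
    constructor
    · rintro ⟨hx, hxB⟩
      exact ⟨⟨x, hx⟩, hxB, rfl⟩
    · rintro ⟨y, hy, rfl⟩
      exact ⟨y.2, hy⟩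
  rw [h]
  exact hs.subtype_image (hc.measurable hB)

variable {E : Type*} [NormedAddCommGroup E] [NormedSpace ℝ E] [FiniteDimensional ℝ E] [MeasurableSpace E] [BorelSpace E]
  (μ : Measure E) [μ.IsAddHaarMeasure]

/-- **THE WEIGHTED CHANGE-OF-VARIABLES INEQUALITY.**  `f` injective and differentiable on a measurable `s`, `w ≥ 0` a weight with the floor
`m·w(x) ≤ |det f′(x)|·w(f x)` on `s` ⟹ `m·∫_s w dμ ≤ ∫_{f(s)} w dμ` (Mathlib's injective change of variables
`lintegral_image_eq_lintegral_abs_det_fderiv_mul`). [folklore] -/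
theorem mul_setLIntegral_le_lintegral_image {f : E → E} {f' : E → E →L[ℝ] E} {s : Set E} (hs : MeasurableSet s)
    (hf' : ∀ x ∈ s, HasFDerivWithinAt f (f' x) s x) (hf : InjOn f s) (w : E → ℝ≥0∞) {m : ℝ≥0∞}
    (hm : ∀ x ∈ s, m * w x ≤ ENNReal.ofReal |(f' x).det| * w (f x)) :
    m * ∫⁻ x in s, w x ∂μ ≤ ∫⁻ y in f '' s, w y ∂μ := by
  rw [lintegral_image_eq_lintegral_abs_det_fderiv_mul μ hs hf' hf w]
  exact (lintegral_const_mul_le m _).trans (setLIntegral_mono' hs fun x hx => hm x hx)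

/-- **… PULLED BACK**: under the same hypotheses, `m·∫_{s ∩ f⁻¹B} w dμ ≤ ∫_B w dμ` for every Borel `B` (apply the inequality on the measurable piece
`s ∩ f⁻¹B`, whose image lies in `B`). [folklore] -/
theorem mul_setLIntegral_inter_preimage_le {f : E → E} {f' : E → E →L[ℝ] E} {s : Set E} (hs : MeasurableSet s)
    (hf' : ∀ x ∈ s, HasFDerivWithinAt f (f' x) s x) (hf : InjOn f s) (w : E → ℝ≥0∞) {m : ℝ≥0∞}
    (hm : ∀ x ∈ s, m * w x ≤ ENNReal.ofReal |(f' x).det| * w (f x)) {B : Set E} (hB : MeasurableSet B) :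
    m * ∫⁻ x in s ∩ f ⁻¹' B, w x ∂μ ≤ ∫⁻ y in B, w y ∂μ := by
  have hcont : ContinuousOn f s := fun x hx => (hf' x hx).continuousWithinAt
  have ht : MeasurableSet (s ∩ f ⁻¹' B) := measurableSet_inter_preimage_of_continuousOn hcont hs hB
  refine (mul_setLIntegral_le_lintegral_image μ ht (fun x hx => (hf' x hx.1).mono inter_subset_left)
    (hf.mono inter_subset_left) w fun x hx => hm x hx.1).trans (lintegral_mono_set ?_)
  rintro _ ⟨x, ⟨-, hxB⟩, rfl⟩
  exact hxB

end General

/-! ## §2 Charts of `SU(2)` carrying `σ(A)dA` to Haar measure; one chart window -/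

section Window

open Literature.MathematicalPhysics.QuantumFieldTheory (haarProbability)
open Literature.MathematicalPhysics.QuantumFieldTheory.Balaban1983to89.B10Eq22Rescaling (sigmaSU2)
open Literature.MathematicalPhysics.QuantumFieldTheory.Balaban1983to89.B10Eq18SigmaSU2Haar
  (expPauli sigmaMeasure measurable_expPauli continuous_expPauli injOn_expPauli map_expPauli_sigmaMeasure)

/-- A CHART in the sense used below is any continuous `χ : ℝ³ → SU(2)`, injective on `{|A| < π}`, pushing print's `σ(A)dA` to Haar measure; its windows
`χ(W)`, `W ⊆ {|A| < π}` measurable, are Borel (Lusin–Souslin). [cite: Balaban1985UV3, p. 260 (the chart; bookkeeping)] -/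
theorem measurableSet_image_chart {χ : EuclideanSpace ℝ (Fin 3) → Matrix.specialUnitaryGroup (Fin 2) ℂ} (hχc : Continuous χ)
    (hχi : InjOn χ (ball (0 : EuclideanSpace ℝ (Fin 3)) Real.pi)) {W : Set (EuclideanSpace ℝ (Fin 3))} (hW : MeasurableSet W)
    (hWπ : W ⊆ ball (0 : EuclideanSpace ℝ (Fin 3)) Real.pi) : MeasurableSet (χ '' W) :=
  hW.image_of_continuousOn_injOn hχc.continuousOn (hχi.mono hWπ)

/-- **HAAR ON A CHART WINDOW**: `Haar↾χ(W) = χ_*(σ(A)dA↾W)` for every chart `χ` and measurable `W ⊆ {|A| < π}` (B10's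
`haarProbability_restrict_image_expPauli` for an arbitrary chart). [cite: Balaban1985UV3, p. 260 (bookkeeping)] -/
theorem restrict_image_chart {χ : EuclideanSpace ℝ (Fin 3) → Matrix.specialUnitaryGroup (Fin 2) ℂ} (hχc : Continuous χ)
    (hχi : InjOn χ (ball (0 : EuclideanSpace ℝ (Fin 3)) Real.pi))
    (hχ : sigmaMeasure.map χ = haarProbability (Matrix.specialUnitaryGroup (Fin 2) ℂ))
    {W : Set (EuclideanSpace ℝ (Fin 3))} (hW : MeasurableSet W) (hWπ : W ⊆ ball (0 : EuclideanSpace ℝ (Fin 3)) Real.pi) :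
    (haarProbability (Matrix.specialUnitaryGroup (Fin 2) ℂ)).restrict (χ '' W) = (sigmaMeasure.restrict W).map χ := by
  rw [← hχ, Measure.restrict_map hχc.measurable (measurableSet_image_chart hχc hχi hW hWπ)]
  congr 1
  rw [sigmaMeasure, ← restrict_withDensity measurableSet_ball, Measure.restrict_restrict
    (hχc.measurable (measurableSet_image_chart hχc hχi hW hWπ)), Measure.restrict_restrict hW,
    hχi.preimage_image_inter hWπ, inter_eq_left.2 hWπ]

/-- The chart law of a Borel set inside the injectivity ball is the weighted Lebesgue integral: `σ(A)dA(t) = ∫_t σ_{SU(2)}(|A|) d³A` for measurable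
`t ⊆ {|A| < π}`. [cite: Balaban1985UV3, p. 260 (bookkeeping)] -/
theorem sigmaMeasure_apply_of_subset {t : Set (EuclideanSpace ℝ (Fin 3))} (ht : MeasurableSet t)
    (htπ : t ⊆ ball (0 : EuclideanSpace ℝ (Fin 3)) Real.pi) :
    sigmaMeasure t = ∫⁻ x in t, ENNReal.ofReal (sigmaSU2 ‖x‖) := by
  rw [sigmaMeasure, withDensity_apply _ ht, Measure.restrict_restrict ht, inter_eq_left.2 htπ]

/-- The Haar mass of a Borel `E ⊆ SU(2)` through a chart: `Haar(E) = ∫_{χ⁻¹E ∩ {|A|<π}} σ_{SU(2)}(|A|) d³A`. [cite: Balaban1985UV3, p. 260 (bookkeeping)] -/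
theorem haar_eq_setLIntegral_preimage_chart {χ : EuclideanSpace ℝ (Fin 3) → Matrix.specialUnitaryGroup (Fin 2) ℂ} (hχm : Measurable χ)
    (hχ : sigmaMeasure.map χ = haarProbability (Matrix.specialUnitaryGroup (Fin 2) ℂ))
    {A : Set (Matrix.specialUnitaryGroup (Fin 2) ℂ)} (hA : MeasurableSet A) :
    haarProbability (Matrix.specialUnitaryGroup (Fin 2) ℂ) A =
      ∫⁻ x in χ ⁻¹' A ∩ ball (0 : EuclideanSpace ℝ (Fin 3)) Real.pi, ENNReal.ofReal (sigmaSU2 ‖x‖) := by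
  have hBm : MeasurableSet (χ ⁻¹' A) := hχm hA
  rw [← hχ, Measure.map_apply hχm hA, sigmaMeasure, withDensity_apply _ hBm, Measure.restrict_restrict hBm]

/-- Through a chart conjugation `ψ(χ₀ A) = χ₁(ψc A)` on `W`, the `χ₀`-preimage of `ψ⁻¹E` inside `W` is `W ∩ ψc⁻¹(χ₁⁻¹E)` (plumbing).
[cite: Balaban1985UV3, p. 260 (bookkeeping)] -/
theorem preimage_inter_window_eq {ψ : Matrix.specialUnitaryGroup (Fin 2) ℂ → Matrix.specialUnitaryGroup (Fin 2) ℂ}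
    {χ₀ χ₁ : EuclideanSpace ℝ (Fin 3) → Matrix.specialUnitaryGroup (Fin 2) ℂ}
    {W : Set (EuclideanSpace ℝ (Fin 3))} {ψc : EuclideanSpace ℝ (Fin 3) → EuclideanSpace ℝ (Fin 3)}
    (hconj : ∀ x ∈ W, ψ (χ₀ x) = χ₁ (ψc x)) (A : Set (Matrix.specialUnitaryGroup (Fin 2) ℂ)) :
    χ₀ ⁻¹' (ψ ⁻¹' A) ∩ W = W ∩ ψc ⁻¹' (χ₁ ⁻¹' A) := by
  ext x
  constructor
  · rintro ⟨hx, hW⟩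
    refine ⟨hW, ?_⟩
    show χ₁ (ψc x) ∈ A
    rw [← hconj x hW]
    exact hx
  · rintro ⟨hW, hx⟩
    refine ⟨?_, hW⟩
    show ψ (χ₀ x) ∈ A
    rw [hconj x hW]
    exact hx

/-- **ONE CHART WINDOW.**  Charts `χ₀` (source) and `χ₁` (target); `W ⊆ {|A| < π}` measurable; `ψ : SU(2) → SU(2)` Borel and conjugate on `W` to
`ψc : ℝ³ → ℝ³` — `ψ(χ₀ A) = χ₁(ψc A)`, `ψc(W) ⊆ {|A| < π}` — with `ψc` injective and differentiable on `W` and the HAAR-JACOBIAN FLOOR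
`m·σ(|A|) ≤ |det ψc′(A)|·σ(|ψc A|)` on `W`.  Then `m · Haar(χ₀(W) ∩ ψ⁻¹E) ≤ Haar(E)` for every Borel `E ⊆ SU(2)`.  (Since `σ = σ₀·det(d exp)`, the floor is
`m ≤ |det dψ|` in Haar-normalised left trivialisations.) [cite: Balaban1985UV3, p. 260 (the chart `dU′ = σ(A′)dA′`; bookkeeping)] -/
theorem mul_haar_window_inter_preimage_le
    {ψ : Matrix.specialUnitaryGroup (Fin 2) ℂ → Matrix.specialUnitaryGroup (Fin 2) ℂ} (hψ : Measurable ψ)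
    {χ₀ χ₁ : EuclideanSpace ℝ (Fin 3) → Matrix.specialUnitaryGroup (Fin 2) ℂ} (hχ₀c : Continuous χ₀)
    (hχ₀i : InjOn χ₀ (ball (0 : EuclideanSpace ℝ (Fin 3)) Real.pi))
    (hχ₀ : sigmaMeasure.map χ₀ = haarProbability (Matrix.specialUnitaryGroup (Fin 2) ℂ)) (hχ₁m : Measurable χ₁)
    (hχ₁ : sigmaMeasure.map χ₁ = haarProbability (Matrix.specialUnitaryGroup (Fin 2) ℂ))
    {W : Set (EuclideanSpace ℝ (Fin 3))} (hW : MeasurableSet W) (hWπ : W ⊆ ball (0 : EuclideanSpace ℝ (Fin 3)) Real.pi)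
    {ψc : EuclideanSpace ℝ (Fin 3) → EuclideanSpace ℝ (Fin 3)}
    {ψc' : EuclideanSpace ℝ (Fin 3) → EuclideanSpace ℝ (Fin 3) →L[ℝ] EuclideanSpace ℝ (Fin 3)}
    (hconj : ∀ x ∈ W, ψ (χ₀ x) = χ₁ (ψc x)) (hmaps : MapsTo ψc W (ball (0 : EuclideanSpace ℝ (Fin 3)) Real.pi))
    (hder : ∀ x ∈ W, HasFDerivWithinAt ψc (ψc' x) W x) (hinj : InjOn ψc W) {m : ℝ≥0∞}
    (hm : ∀ x ∈ W, m * ENNReal.ofReal (sigmaSU2 ‖x‖) ≤ ENNReal.ofReal |(ψc' x).det| * ENNReal.ofReal (sigmaSU2 ‖ψc x‖))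
    {A : Set (Matrix.specialUnitaryGroup (Fin 2) ℂ)} (hA : MeasurableSet A) :
    m * haarProbability (Matrix.specialUnitaryGroup (Fin 2) ℂ) (χ₀ '' W ∩ ψ ⁻¹' A) ≤
      haarProbability (Matrix.specialUnitaryGroup (Fin 2) ℂ) A := by
  have hBm : MeasurableSet (χ₁ ⁻¹' A) := hχ₁m hA
  have hcont : ContinuousOn ψc W := fun x hx => (hder x hx).continuousWithinAt
  have ht : MeasurableSet (W ∩ ψc ⁻¹' (χ₁ ⁻¹' A)) := measurableSet_inter_preimage_of_continuousOn hcont hW hBm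
  have h1 : haarProbability (Matrix.specialUnitaryGroup (Fin 2) ℂ) (χ₀ '' W ∩ ψ ⁻¹' A) =
      ∫⁻ x in W ∩ ψc ⁻¹' (χ₁ ⁻¹' A), ENNReal.ofReal (sigmaSU2 ‖x‖) := by
    rw [inter_comm, ← Measure.restrict_apply (hψ hA), restrict_image_chart hχ₀c hχ₀i hχ₀ hW hWπ,
      Measure.map_apply hχ₀c.measurable (hψ hA), Measure.restrict_apply (hχ₀c.measurable (hψ hA)),
      preimage_inter_window_eq hconj A, sigmaMeasure_apply_of_subset ht (inter_subset_left.trans hWπ)]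
  have h3 : ψc '' (W ∩ ψc ⁻¹' (χ₁ ⁻¹' A)) ⊆ χ₁ ⁻¹' A ∩ ball (0 : EuclideanSpace ℝ (Fin 3)) Real.pi := by
    rintro _ ⟨x, ⟨hxW, hxB⟩, rfl⟩
    exact ⟨hxB, hmaps hxW⟩
  calc m * haarProbability (Matrix.specialUnitaryGroup (Fin 2) ℂ) (χ₀ '' W ∩ ψ ⁻¹' A)
      = m * ∫⁻ x in W ∩ ψc ⁻¹' (χ₁ ⁻¹' A), ENNReal.ofReal (sigmaSU2 ‖x‖) := by rw [h1]
    _ ≤ ∫⁻ y in ψc '' (W ∩ ψc ⁻¹' (χ₁ ⁻¹' A)), ENNReal.ofReal (sigmaSU2 ‖y‖) :=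
        mul_setLIntegral_le_lintegral_image volume ht (fun x hx => (hder x hx.1).mono inter_subset_left)
          (hinj.mono inter_subset_left) _ fun x hx => hm x hx.1
    _ ≤ ∫⁻ y in χ₁ ⁻¹' A ∩ ball (0 : EuclideanSpace ℝ (Fin 3)) Real.pi, ENNReal.ofReal (sigmaSU2 ‖y‖) :=
        lintegral_mono_set h3
    _ = haarProbability (Matrix.specialUnitaryGroup (Fin 2) ℂ) A := (haar_eq_setLIntegral_preimage_chart hχ₁m hχ₁ hA).symm

/-! ### The charts: print's `A ↦ exp iA` (centred at `1`) and its left translates `A ↦ g·exp iA` (centred anywhere) -/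

/-- Print's chart `A ↦ exp(iΣA^aσ_a)` is a chart in the above sense (B10: continuity, injectivity on `{|A|<π}`, `(exp i·)_*σ(A)dA = dU`).
[cite: Balaban1985UV3, p. 260] -/
theorem chart_expPauli :
    Continuous expPauli ∧ InjOn expPauli (ball (0 : EuclideanSpace ℝ (Fin 3)) Real.pi) ∧
      sigmaMeasure.map expPauli = haarProbability (Matrix.specialUnitaryGroup (Fin 2) ℂ) :=
  ⟨continuous_expPauli, injOn_expPauli, map_expPauli_sigmaMeasure⟩

/-- The LEFT-TRANSLATED chart `A ↦ g·exp iA` (centred at `g`) is continuous. [cite: Balaban1985UV3, p. 260 (bookkeeping)] -/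
theorem continuous_mul_expPauli (g : Matrix.specialUnitaryGroup (Fin 2) ℂ) :
    Continuous fun A : EuclideanSpace ℝ (Fin 3) => g * expPauli A :=
  continuous_const.mul continuous_expPauli

/-- … injective on `{|A| < π}`. [cite: Balaban1985UV3, p. 260 (bookkeeping)] -/
theorem injOn_mul_expPauli (g : Matrix.specialUnitaryGroup (Fin 2) ℂ) :
    InjOn (fun A : EuclideanSpace ℝ (Fin 3) => g * expPauli A) (ball (0 : EuclideanSpace ℝ (Fin 3)) Real.pi) :=
  fun _ hx _ hy h => injOn_expPauli hx hy (mul_left_cancel h)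

/-- … and pushes `σ(A)dA` to Haar measure (left invariance of `dU`). [cite: Balaban1985UV3, p. 260 (bookkeeping)] -/
theorem map_mul_expPauli_sigmaMeasure (g : Matrix.specialUnitaryGroup (Fin 2) ℂ) :
    sigmaMeasure.map (fun A : EuclideanSpace ℝ (Fin 3) => g * expPauli A) = haarProbability (Matrix.specialUnitaryGroup (Fin 2) ℂ) := by
  haveI : (haarProbability (Matrix.specialUnitaryGroup (Fin 2) ℂ)).IsMulLeftInvariant := by
    unfold haarProbability
    infer_instance
  have h : (fun A : EuclideanSpace ℝ (Fin 3) => g * expPauli A) = (fun U => g * U) ∘ expPauli := rfl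
  rw [h, ← Measure.map_map (measurable_const_mul g) measurable_expPauli, map_expPauli_sigmaMeasure, map_mul_left_eq_self]

end Window

/-! ## §3 [folklore] Windows add up; the (H_K) assembly -/

section Pieces

variable {α : Type*} [MeasurableSpace α] (μ : Measure α)

/-- **WINDOWS ADD UP.**  If `S` is covered by finitely many pieces `V_k`, `k ∈ K`, each obeying `m·μ(V_k ∩ ψ⁻¹E) ≤ μ(E)` for all Borel `E`, then
`m·μ(S ∩ ψ⁻¹E) ≤ #K·μ(E)` (subadditivity). [folklore] -/
theorem mul_measure_inter_preimage_le_card_mul {ι : Type*} (K : Finset ι) (V : ι → Set α) {ψ : α → α} {m : ℝ≥0∞}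
    (hV : ∀ k ∈ K, ∀ A, MeasurableSet A → m * μ (V k ∩ ψ ⁻¹' A) ≤ μ A) {S : Set α} (hS : S ⊆ ⋃ k ∈ K, V k)
    {A : Set α} (hA : MeasurableSet A) : m * μ (S ∩ ψ ⁻¹' A) ≤ K.card * μ A := by
  have hsub : S ∩ ψ ⁻¹' A ⊆ ⋃ k ∈ K, (V k ∩ ψ ⁻¹' A) := by
    rintro x ⟨hxS, hxA⟩
    obtain ⟨k, hk, hxk⟩ := mem_iUnion₂.1 (hS hxS)
    exact mem_iUnion₂.2 ⟨k, hk, hxk, hxA⟩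
  calc m * μ (S ∩ ψ ⁻¹' A) ≤ m * μ (⋃ k ∈ K, (V k ∩ ψ ⁻¹' A)) := mul_le_mul' le_rfl (measure_mono hsub)
    _ ≤ m * ∑ k ∈ K, μ (V k ∩ ψ ⁻¹' A) := mul_le_mul' le_rfl (measure_biUnion_finset_le K _)
    _ = ∑ k ∈ K, m * μ (V k ∩ ψ ⁻¹' A) := Finset.mul_sum _ _ _
    _ ≤ ∑ k ∈ K, μ A := Finset.sum_le_sum fun k hk => hV k hk A hA
    _ = K.card * μ A := by rw [Finset.sum_const, nsmul_eq_mul]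

/-- The set-wise bound as a MEASURE inequality: `(∀ Borel E, m·μ(S ∩ ψ⁻¹E) ≤ c·μ(E))` ⟹ `m • (μ↾S)∘ψ⁻¹ ≤ c • μ` (`ψ` Borel). [folklore] -/
theorem smul_map_restrict_le {ψ : α → α} (hψ : Measurable ψ) {S : Set α} {m c : ℝ≥0∞}
    (h : ∀ A, MeasurableSet A → m * μ (S ∩ ψ ⁻¹' A) ≤ c * μ A) : m • (μ.restrict S).map ψ ≤ c • μ := by
  rw [Measure.le_iff]
  intro A hA
  rw [Measure.smul_apply, Measure.smul_apply, smul_eq_mul, smul_eq_mul, Measure.map_apply hψ hA,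
    Measure.restrict_apply (hψ hA), inter_comm]
  exact h A hA

/-- … divided through: for `0 < m < ∞`, `(μ↾S)∘ψ⁻¹ ≤ (m⁻¹·c) • μ`. [folklore] -/
theorem map_restrict_le_smul {ψ : α → α} (hψ : Measurable ψ) {S : Set α} {m c : ℝ≥0∞} (hm0 : m ≠ 0) (hmt : m ≠ ∞)
    (h : ∀ A, MeasurableSet A → m * μ (S ∩ ψ ⁻¹' A) ≤ c * μ A) : (μ.restrict S).map ψ ≤ (m⁻¹ * c) • μ := by
  rw [Measure.le_iff]
  intro A hA
  rw [Measure.smul_apply, smul_eq_mul, Measure.map_apply hψ hA, Measure.restrict_apply (hψ hA), inter_comm]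
  calc μ (S ∩ ψ ⁻¹' A) = m⁻¹ * (m * μ (S ∩ ψ ⁻¹' A)) := by rw [← mul_assoc, ENNReal.inv_mul_cancel hm0 hmt, one_mul]
    _ ≤ m⁻¹ * (c * μ A) := mul_le_mul' le_rfl (h A hA)
    _ = m⁻¹ * c * μ A := (mul_assoc _ _ _).symm

/-- **THE (H_K) ASSEMBLY.**  If `(μ↾S)∘ψ⁻¹ ≤ c • μ` on a measurable `S` and OFF `S` the map `ψ` agrees with a `μ`-preserving Borel map `τ`
(`μ∘τ⁻¹ ≤ μ` suffices), then `μ ∘ ψ⁻¹ ≤ (c + 1) • μ`. [folklore] -/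
theorem map_le_smul_of_restrict {ψ τ : α → α} (hψ : Measurable ψ) (hτ : Measurable τ) (hτμ : μ.map τ ≤ μ)
    {S : Set α} (hS : MeasurableSet S) (heq : ∀ x, x ∉ S → ψ x = τ x) {c : ℝ≥0∞} (h : (μ.restrict S).map ψ ≤ c • μ) :
    μ.map ψ ≤ (c + 1) • μ := by
  have hsplit : μ.map ψ = (μ.restrict S).map ψ + (μ.restrict Sᶜ).map ψ := by
    rw [← Measure.map_add _ _ hψ, Measure.restrict_add_restrict_compl hS]
  have hae : ψ =ᵐ[μ.restrict Sᶜ] τ := (ae_restrict_mem hS.compl).mono fun x hx => heq x hx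
  have h2 : (μ.restrict Sᶜ).map ψ ≤ μ :=
    calc (μ.restrict Sᶜ).map ψ = (μ.restrict Sᶜ).map τ := Measure.map_congr hae
      _ ≤ μ.map τ := Measure.map_mono Measure.restrict_le_self hτ
      _ ≤ μ := hτμ
  rw [hsplit, add_smul, one_smul]
  exact add_le_add h h2

end Pieces

/-! ## §4 The frame at `SU(2)`: (H_K)'s shape from windows centred anywhere -/

section Frame

open Literature.MathematicalPhysics.QuantumFieldTheory (haarProbability)
open Literature.MathematicalPhysics.QuantumFieldTheory.Balaban1983to89.B10Eq22Rescaling (sigmaSU2)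
open Literature.MathematicalPhysics.QuantumFieldTheory.Balaban1983to89.B10Eq18SigmaSU2Haar (expPauli measurable_expPauli)

/-- **WINDOWS ON `SU(2)` ADD UP**: finitely many windows `g₀(k)·exp(iW_k)`, `W_k ⊆ {|A| < π}` measurable, `k ∈ K`, on each of which `ψ` is conjugate —
`ψ(g₀(k)·exp iA) = g₁(k)·exp(iψc_k(A))` — to an injective differentiable `ψc_k` with `ψc_k(W_k) ⊆ {|A| < π}` and the common Haar-Jacobian floor `m`, covering
`S ⊆ ⋃_k g₀(k)·exp(iW_k)` ⟹ `m · Haar(S ∩ ψ⁻¹E) ≤ #K · Haar(E)` for every Borel `E`. [cite: Balaban1985UV3, p. 260 (the chart; bookkeeping)] -/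
theorem mul_haar_inter_preimage_le_card_mul
    {ψ : Matrix.specialUnitaryGroup (Fin 2) ℂ → Matrix.specialUnitaryGroup (Fin 2) ℂ} (hψ : Measurable ψ)
    {ι : Type*} (K : Finset ι) (g₀ g₁ : ι → Matrix.specialUnitaryGroup (Fin 2) ℂ) (W : ι → Set (EuclideanSpace ℝ (Fin 3)))
    (hW : ∀ k ∈ K, MeasurableSet (W k)) (hWπ : ∀ k ∈ K, W k ⊆ ball (0 : EuclideanSpace ℝ (Fin 3)) Real.pi)
    (ψc : ι → EuclideanSpace ℝ (Fin 3) → EuclideanSpace ℝ (Fin 3))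
    (ψc' : ι → EuclideanSpace ℝ (Fin 3) → EuclideanSpace ℝ (Fin 3) →L[ℝ] EuclideanSpace ℝ (Fin 3))
    (hconj : ∀ k ∈ K, ∀ x ∈ W k, ψ (g₀ k * expPauli x) = g₁ k * expPauli (ψc k x))
    (hmaps : ∀ k ∈ K, MapsTo (ψc k) (W k) (ball (0 : EuclideanSpace ℝ (Fin 3)) Real.pi))
    (hder : ∀ k ∈ K, ∀ x ∈ W k, HasFDerivWithinAt (ψc k) (ψc' k x) (W k) x) (hinj : ∀ k ∈ K, InjOn (ψc k) (W k)) {m : ℝ≥0∞}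
    (hm : ∀ k ∈ K, ∀ x ∈ W k,
      m * ENNReal.ofReal (sigmaSU2 ‖x‖) ≤ ENNReal.ofReal |(ψc' k x).det| * ENNReal.ofReal (sigmaSU2 ‖ψc k x‖))
    {S : Set (Matrix.specialUnitaryGroup (Fin 2) ℂ)} (hS : S ⊆ ⋃ k ∈ K, (fun A => g₀ k * expPauli A) '' W k)
    {A : Set (Matrix.specialUnitaryGroup (Fin 2) ℂ)} (hA : MeasurableSet A) :
    m * haarProbability (Matrix.specialUnitaryGroup (Fin 2) ℂ) (S ∩ ψ ⁻¹' A) ≤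
      K.card * haarProbability (Matrix.specialUnitaryGroup (Fin 2) ℂ) A :=
  mul_measure_inter_preimage_le_card_mul _ K (fun k => (fun A => g₀ k * expPauli A) '' W k)
    (fun k hk _ hB => mul_haar_window_inter_preimage_le hψ (continuous_mul_expPauli (g₀ k)) (injOn_mul_expPauli (g₀ k))
      (map_mul_expPauli_sigmaMeasure (g₀ k)) (continuous_mul_expPauli (g₁ k)).measurable (map_mul_expPauli_sigmaMeasure (g₁ k))
      (hW k hk) (hWπ k hk) (hconj k hk) (hmaps k hk) (hder k hk) (hinj k hk) (hm k hk) hB) hS hA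

/-- ★ **THE ENGINE FRAME FOR (H_K) AT `N = 2`.**  Let `ψ : SU(2) → SU(2)` be Borel; let `S ⊆ SU(2)` be measurable and covered by finitely many windows
`g₀(k)·exp(iW_k)`, `k ∈ K` (`W_k ⊆ {|A| < π}` measurable), on each of which `ψ(g₀(k)·exp iA) = g₁(k)·exp(iψc_k(A))` with `ψc_k : ℝ³ → ℝ³` injective and
differentiable on `W_k`, `ψc_k(W_k) ⊆ {|A| < π}`, and the Haar-Jacobian floor `m·σ(|A|) ≤ |det ψc_k′(A)|·σ(|ψc_k A|)`, `0 < m < ∞`; and let `ψ` agree OFF `S`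
with a Borel `τ` preserving Haar measure (`Haar∘τ⁻¹ ≤ Haar`).  Then **`Haar ∘ ψ⁻¹ ≤ (m⁻¹·#K + 1) • Haar`** — the shape of part 20's hypothesis (H_K) with
`K = m⁻¹·#windows + 1` (`HaarData.haar = haarProbability SU(2)` by `rfl`).  What it does NOT supply: the windows, their number, and the floor for the
printed fibre map. [cite: Balaban1985UV3, p. 260 (the chart `dU′ = σ(A′)dA′`; bookkeeping)] -/
theorem haar_map_le_of_windows
    {ψ τ : Matrix.specialUnitaryGroup (Fin 2) ℂ → Matrix.specialUnitaryGroup (Fin 2) ℂ} (hψ : Measurable ψ) (hτ : Measurable τ)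
    (hτμ : (haarProbability (Matrix.specialUnitaryGroup (Fin 2) ℂ)).map τ ≤ haarProbability (Matrix.specialUnitaryGroup (Fin 2) ℂ))
    {S : Set (Matrix.specialUnitaryGroup (Fin 2) ℂ)} (hSm : MeasurableSet S) (heq : ∀ x, x ∉ S → ψ x = τ x)
    {ι : Type*} (K : Finset ι) (g₀ g₁ : ι → Matrix.specialUnitaryGroup (Fin 2) ℂ) (W : ι → Set (EuclideanSpace ℝ (Fin 3)))
    (hW : ∀ k ∈ K, MeasurableSet (W k)) (hWπ : ∀ k ∈ K, W k ⊆ ball (0 : EuclideanSpace ℝ (Fin 3)) Real.pi)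
    (ψc : ι → EuclideanSpace ℝ (Fin 3) → EuclideanSpace ℝ (Fin 3))
    (ψc' : ι → EuclideanSpace ℝ (Fin 3) → EuclideanSpace ℝ (Fin 3) →L[ℝ] EuclideanSpace ℝ (Fin 3))
    (hconj : ∀ k ∈ K, ∀ x ∈ W k, ψ (g₀ k * expPauli x) = g₁ k * expPauli (ψc k x))
    (hmaps : ∀ k ∈ K, MapsTo (ψc k) (W k) (ball (0 : EuclideanSpace ℝ (Fin 3)) Real.pi))
    (hder : ∀ k ∈ K, ∀ x ∈ W k, HasFDerivWithinAt (ψc k) (ψc' k x) (W k) x) (hinj : ∀ k ∈ K, InjOn (ψc k) (W k))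
    {m : ℝ≥0∞} (hm0 : m ≠ 0) (hmt : m ≠ ∞)
    (hm : ∀ k ∈ K, ∀ x ∈ W k,
      m * ENNReal.ofReal (sigmaSU2 ‖x‖) ≤ ENNReal.ofReal |(ψc' k x).det| * ENNReal.ofReal (sigmaSU2 ‖ψc k x‖))
    (hS : S ⊆ ⋃ k ∈ K, (fun A => g₀ k * expPauli A) '' W k) :
    (haarProbability (Matrix.specialUnitaryGroup (Fin 2) ℂ)).map ψ ≤
      (m⁻¹ * K.card + 1) • haarProbability (Matrix.specialUnitaryGroup (Fin 2) ℂ) :=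
  map_le_smul_of_restrict _ hψ hτ hτμ hSm heq
    (map_restrict_le_smul _ hψ hm0 hmt fun _ hA =>
      mul_haar_inter_preimage_le_card_mul hψ K g₀ g₁ W hW hWπ ψc ψc' hconj hmaps hder hinj hm hS hA)

end Frame

end Summit.QuantumFields.YangMills.BalabanUVNodes.N08HaarCompatibilityGuardChartTransfer

end
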